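import Summits.QuantumFields.BalabanUV.T4Continuum.Support.NE3SlicePoincareCompetitorEnergy
import HarnessLib

/-!
# NE3SlicePoincareCompetitorEnd (T⁴ programme, node NE3, row K6, cut ρ-g23-3 §3 part K6c-1b-β, file 2∕2) — THE S7 COMPETITOR OF ROUTE H♮, NESTED-MEAN FIXED:
# `ζ̃ − ζ′ ∈ Ξ₀₀(W)` AND ITS ENERGY IN THE K6 LETTERS
Leaf seat `b2b-balaban-t4-ne3-formalise-leaf-02` (gen 6), row K6.  BY NAME: file 1∕2 `NE3SlicePoincareCompetitorEnergy` (§2 `sum_normSq_gaugeDir_F0_le`, §3), leaf-01-g6's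
6c `NE3CompetitorSlice.{nfixCompetitorW, nfixCompetitorW_sub_mem_cornerGaugeSpaceW, sum_normSq_gaugeDir_nfixCompetitorW_le}` (the nested-mean fix of ρ-g23-5 on the owner's K5-inv),
`NE3NestedMeanBlockOperator.inv_le_tentMean`.  WHAT ([folklore]; 0 sorry; 0 def; letters as in file 1∕2):
`two_div_tentMean_sq_le` (`(2∕tentMean)² ≤ 4·64^d`), `competitor_arith` (letters only), **`exists_competitor`**: in the tower class (`3 ≤ d`, `2 ≤ L`, `1 ≤ N`,
unitary `W` of period `tower L N (k+1)`, `0 ≤ x`, `LevelSmall d L k x`, `SmallField W x`, `S2sum ≤ ρ∕2`, J2's `E_k ≤ 1∕2`, K6-Ξ's displayed smallness), for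
`Y ∈ frameFreeBlockLandauW L N (k+1) W` and ANY split `Y = η′ + gaugeDir W ζ′`: `∃ ζ̃` periodic, 𝔲(n)-valued, `ζ̃ − ζ′ ∈ cornerGaugeSpaceW L (k+1) W (tower L N (k+1)) (L^{k+1})`,
`ΣΣ nhsNormSq (gaugeDir W ζ̃) ≤ 2B₅ + 16dκ²·64^d·C_J²·card n·(8M²B₅ + 8M²G_ζ + (4·card n·C_J² + 1)Z)`.
HONEST FRAMING.  Kinematics + bookkeeping of OUR competitor at ONE unitary background in the tower's small-field class; nothing about Bałaban's minimisers; (P♮)_W, (ML_w) at `W ≠ 1`,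
T-E_w and NE3 are NOT proved; spine PROVED 0∕9; finite T⁴ rung (B)+1 — NOT infinite volume, NOT mass gap, NOT BetaPertH, NOT Clay.  ABSOLUTE RULE kept: no printed sentence is a hypothesis.
PLACEMENT: `Summits/QuantumFields/BalabanUV/`.  HONEST DEPENDENCY: continuum YM on T⁴ ⇐ BetaPertH ∧ nine spine estimates (0/9 proved); BetaPertH ⇐ (D1) ∧ (D4) ∧ CAP+tail; G-an2-4 gates asym, D1 and NE2/3/4.
-/

set_option autoImplicit false

open scoped BigOperators Matrix.Norms.L2Operator
open Finset

namespace Summit.QuantumFields.BalabanUV.T4Continuum.NE3SlicePoincareCompetitorEnd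

open Literature.MathematicalPhysics.QuantumFieldTheory.Balaban1983to89
open B7Prop1Explicit B7Prop2Explicit MatrixNorms
open T4AveragingDeficitWall (IsUnitaryCfg IsSkewDir SmallField Ad)
open T4AveragingDeficitWallBoundary (IsPeriodicCfg periodBox)
open AveragingDeficitPeriodicCounting (IsPeriodicDir)
open AveragingDeficitTwoLevelPrep (prop1Radius)
open AveragingDeficitMultiLevelPrep (cavgIter tower LevelSmall radIter cavgIter_unitary_small isPeriodicCfg_cavgIter)
open AveragingDeficitBlockDensity (bseg)
open SpreadLift (loopRad)
open BlockAveragePushDirGauge (gaugeDir)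
open NE3CovariantCalculus (nhsNormSq_sub_le)
open NE3CovariantBlockMean (bmeanW bmeanIterW bmeanIterW_skew_periodic)
open NE3FrameFreeSliceW (frameFreeBlockLandauW cornerGaugeSpaceW mem_cornerGaugeSpaceW_iff bmeanW_add bmeanIterW_add)
open NE3CurvedCornerGaugeSpace (cornerGaugeSpace₀)
open NE3CovariantLineSumsL2Tower (rho S2sum)
open NE3ExactLineSumsTower (DSum)
open NE3NestedMeanBlockOperator (tentMean tentMean_pos inv_le_tentMean)
open NE3NestedBlockMeanBridge (sum_norm_bmeanIterW_sub_bmeanW_sq_le sum_nhsNormSq_bmeanIterW_sub_bmeanW_le)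
open NE3CornerGaugePoincare (sum_nhsNormSq_le_two_blocks)
open NE3CovariantCompetitor (competitorW competitorW_corner bmeanW_competitorW competitorW_mem_skewAdjoint competitorW_add_period
  sum_normSq_gaugeDir_competitorW_le)
open NE3CompetitorSlice (nfixCompetitorW nfixCompetitorW_sub_mem_cornerGaugeSpaceW sum_normSq_gaugeDir_nfixCompetitorW_le)
open NE3TowerBondVsSegment (norm_cavgIter_sub_bseg_le_top)
open NE3SlicePoincareSkeleton (gaugeDir_sub_fun')
open NE3SlicePoincareRemainderE (sum_norm_sq_le_card_mul sum_sum_norm_sq_le_card_mul)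
open NE3SlicePoincareCompetitorEnergy (sum_normSq_gaugeDir_F0_le sum_nhsNormSq_F0_sub_le pow_mul_sum_normSq_target_sub_le)

noncomputable section

variable {d : ℕ} {n : Type*} [Fintype n] [DecidableEq n]

/-- `(2∕tentMean)² ≤ 4·64^d` (`tentMean ≥ 8^{−d}`, `M ≥ 2`). [folklore] -/
theorem two_div_tentMean_sq_le {M : ℕ} (hM : 2 ≤ M) (d : ℕ) : (2 / tentMean d M) ^ 2 ≤ 4 * (64 : ℝ) ^ d := by
  have ht := tentMean_pos hM d
  have h8 := inv_le_tentMean hM d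
  have h1 : 2 / tentMean d M ≤ 2 * (8 : ℝ) ^ d := by
    rw [div_le_iff₀ ht]
    have : (1 : ℝ) ≤ (8 : ℝ) ^ d * tentMean d M := by
      have h := mul_le_mul_of_nonneg_left h8 (show (0 : ℝ) ≤ (8 : ℝ) ^ d by positivity)
      rwa [mul_inv_cancel₀ (by positivity : (8 : ℝ) ^ d ≠ 0)] at h
    nlinarith
  have h0 : 0 ≤ 2 / tentMean d M := by positivity
  have h64 : (64 : ℝ) ^ d = ((8 : ℝ) ^ d) ^ 2 := by rw [← pow_mul, mul_comm, pow_mul]; norm_num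
  rw [h64]
  nlinarith [h1, h0]

/-- THE SCALAR BOOKKEEPING OF THE END (letters only): from `G̃ ≤ G̃_op ≤ 2G₀ + 2(d·M^d·κ²)(τ²·T)`, `G₀ ≤ B₅`, `M^d·T ≤ 2C_J²(cn·Ξ₀) + 2C_J²(cn·Z)`,
`Ξ₀ ≤ 8M²G₀ + 8M²G_ζ + 4(cn·C_J²·Z)`, `τ² ≤ 4·64^d` and signs:
`G̃ ≤ 2B₅ + 16dκ²·64^d·C_J²·cn·(8M²B₅ + 8M²G_ζ + (4cn·C_J² + 1)Z)`. [folklore] -/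
theorem competitor_arith {Gt Gop G0 B5 T X0 Gz Zs CJ2 κ2 τ2 cn M2 Md dd s64 : ℝ}
    (hnhs : Gt ≤ Gop) (hG : Gop ≤ 2 * G0 + 2 * (dd * Md * κ2) * (τ2 * T)) (h5 : G0 ≤ B5)
    (hT : Md * T ≤ 2 * CJ2 * (cn * X0) + 2 * CJ2 * (cn * Zs)) (hΞ : X0 ≤ 8 * M2 * G0 + 8 * M2 * Gz + 4 * (cn * CJ2 * Zs))
    (hτ : τ2 ≤ 4 * s64) (hκ0 : 0 ≤ κ2) (hτ0 : 0 ≤ τ2) (hC0 : 0 ≤ CJ2) (hG00 : 0 ≤ G0) (hGz0 : 0 ≤ Gz) (hZ0 : 0 ≤ Zs)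
    (hcn0 : 0 ≤ cn) (hM20 : 0 ≤ M2) (hd0 : 0 ≤ dd) :
    Gt ≤ 2 * B5 + 16 * dd * κ2 * s64 * CJ2 * cn * (8 * M2 * B5 + 8 * M2 * Gz + (4 * cn * CJ2 + 1) * Zs) := by
  have hB50 : 0 ≤ B5 := hG00.trans h5
  set Q := 8 * M2 * B5 + 8 * M2 * Gz + (4 * cn * CJ2 + 1) * Zs with hQ
  have hQ0 : 0 ≤ Q := by
    have h1 : 0 ≤ (4 * cn * CJ2 + 1) * Zs := mul_nonneg (by positivity) hZ0
    have h2 : 0 ≤ 8 * M2 * B5 := by positivity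
    have h3 : 0 ≤ 8 * M2 * Gz := by positivity
    linarith
  have hTr : Md * T ≤ 2 * CJ2 * cn * Q := by
    have a1 := mul_le_mul_of_nonneg_left hΞ (show 0 ≤ 2 * CJ2 * cn by positivity)
    have a2 := mul_le_mul_of_nonneg_left h5 (show 0 ≤ 2 * CJ2 * cn * (8 * M2) by positivity)
    rw [hQ]
    linarith [hT, a1, a2]
  have b1 : τ2 * (Md * T) ≤ τ2 * (2 * CJ2 * cn * Q) := mul_le_mul_of_nonneg_left hTr hτ0
  have b2 : τ2 * (2 * CJ2 * cn * Q) ≤ (4 * s64) * (2 * CJ2 * cn * Q) :=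
    mul_le_mul_of_nonneg_right hτ (mul_nonneg (by positivity) hQ0)
  have b3 := mul_le_mul_of_nonneg_left (b1.trans b2) (show 0 ≤ 2 * dd * κ2 by positivity)
  have e1 : 2 * (dd * Md * κ2) * (τ2 * T) = 2 * dd * κ2 * (τ2 * (Md * T)) := by ring
  rw [hQ] at b3
  linarith [hnhs, hG, h5, b3, e1]

/-- **THE S7 COMPETITOR OF ROUTE H♮ (THE END OF K6c-1b-β).**  In the tower class (`3 ≤ d`, `2 ≤ L`, `1 ≤ N`, unitary `W` of period
`tower L N (k+1)`, `0 ≤ x`, `LevelSmall d L k x`, `SmallField W x`, `S2sum ≤ ρ∕2`, J2's `E_k ≤ 1∕2`, K6-Ξ's displayed smallness), for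
`Y ∈ frameFreeBlockLandauW L N (k+1) W` and ANY split `Y = η′ + gaugeDir W ζ′` (η′ periodic; ζ′ periodic, 𝔲(n)-valued) there is a gauge parameter
`ζ̃` (:= leaf-01-g6's `NE3CompetitorSlice.nfixCompetitorW … (bmeanIterW ζ′) ζ′ = nfixW (competitorW M W (bmeanIterW ζ′) (ζ′∘corners)) (bmeanIterW ζ′)`,
membership BY NAME `nfixCompetitorW_sub_mem_cornerGaugeSpaceW`), periodic and 𝔲(n)-valued, with
`ζ̃ − ζ′ ∈ cornerGaugeSpaceW L (k+1) W (tower L N (k+1)) (L^{k+1})` (= `Ξ₀₀(W)`: exact corners, vanishing NESTED transported block means) and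
`ΣΣ nhsNormSq (gaugeDir W ζ̃) ≤ 2·B₅ + 16dκ²·64^d·C_J²·card n·(8M²·B₅ + 8M²·G_ζ + (4·card n·C_J² + 1)·Z)` (module docstring). [folklore] -/
theorem exists_competitor [Nonempty n] (hd : 3 ≤ d) {L N : ℕ} (hL : 2 ≤ L) (hN : 1 ≤ N) (k : ℕ)
    {W : Site d → Fin d → (Matrix n n ℂ)ˣ} {x : ℝ} (hWu : IsUnitaryCfg W) (hWP : IsPeriodicCfg W ((tower L N (k + 1) : ℕ) : ℤ))
    (hx : 0 ≤ x) (hs : LevelSmall d L k x) (hWx : SmallField W x) (hS2 : S2sum d L (k + 1) x ≤ rho d L / 2)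
    (hE : 4 * (d : ℝ) ^ 2 * ((L : ℝ) ^ (k + 1) - 1) ^ 2 * x + 16 * d * loopRad d L ((prop1Radius d L)^[k] x) ≤ 1 / 2)
    (hsmall : 8 * d * (((L : ℝ) ^ (k + 1)) * (((d : ℝ) - 1) * (((L : ℝ) ^ (k + 1)) - 1) * x)) ^ 2
      + 2 * (Fintype.card n * (4 * (d : ℝ) ^ 2 * ((L : ℝ) ^ (k + 1) - 1) ^ 2 * x + 16 * d * loopRad d L ((prop1Radius d L)^[k] x)) ^ 2)
        ≤ 1 / 2)
    {Y : Site d → Fin d → Matrix n n ℂ} (hY : Y ∈ frameFreeBlockLandauW (d := d) (n := n) L N (k + 1) W)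
    {η' : Site d → Fin d → Matrix n n ℂ} (hη'P : IsPeriodicDir η' ((tower L N (k + 1) : ℕ) : ℤ)) {ζ' : Site d → Matrix n n ℂ}
    (hζ'P : ∀ (y : Site d) (τ : Fin d), ζ' (y + ((tower L N (k + 1) : ℕ) : ℤ) • e τ) = ζ' y)
    (hζ's : ∀ y : Site d, ζ' y ∈ skewAdjoint (Matrix n n ℂ))
    (hYeq : ∀ (y : Site d) (κ : Fin d), Y y κ = η' y κ + gaugeDir W ζ' y κ) :
    ∃ ζt : Site d → Matrix n n ℂ,
      (fun y => ζt y - ζ' y) ∈ cornerGaugeSpaceW (d := d) (n := n) L (k + 1) W (tower L N (k + 1)) (L ^ (k + 1))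
      ∧ (∀ (y : Site d) (τ : Fin d), ζt (y + ((tower L N (k + 1) : ℕ) : ℤ) • e τ) = ζt y)
      ∧ (∀ y : Site d, ζt y ∈ skewAdjoint (Matrix n n ℂ))
      ∧ ∑ y ∈ periodBox (d := d) (L ^ (k + 1) * N), ∑ α : Fin d, nhsNormSq (gaugeDir W ζt y α)
          ≤ 2 * (3 * ((2 : ℝ) ^ (d + 1) * (((L : ℝ) ^ (k + 1)) ^ 2)⁻¹ * ((Fintype.card n : ℝ) * (2 * ((L : ℝ) ^ (k + 1)) ^ 2 * ∑ y ∈ periodBox (d := d) (L ^ (k + 1) * N), ∑ κ : Fin d, nhsNormSq (η' y κ) + 2 * (4 * (2 * ((4 * d + 5) / 10 * DSum d L (k + 1) x)) ^ 2 * ((L : ℝ) ^ (k + 1)) ^ 2 * ((Fintype.card n : ℝ) * ∑ y ∈ periodBox (d := d) (L ^ (k + 1) * N), ∑ κ : Fin d, nhsNormSq (η' y κ)) + 16 * S2sum d L (k + 1) x ^ 2 * ((L : ℝ) ^ d * ((L : ℝ) ^ k) ^ 2) * ((Fintype.card n : ℝ) * ∑ y ∈ periodBox (d := d) (L ^ (k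 + 1) * N), ∑ κ : Fin d, nhsNormSq (Y y κ)) + 2 * ((d : ℝ) * (20 * loopRad d L ((prop1Radius d L)^[k] x)) ^ 2) * ((Fintype.card n : ℝ) * ∑ y ∈ periodBox (d := d) (L ^ (k + 1) * N), nhsNormSq (ζ' y))))) + (d : ℝ) * (2 : ℝ) ^ d * (8 * ((d : ℝ) * ((L : ℝ) ^ (k + 1)) * x) ^ 2 + (16 / ((L : ℝ) ^ (k + 1)) ^ 2) * (8 * loopRad d L ((prop1Radius d L)^[k] x) + 9 * (d : ℝ) ^ 2 * ((L : ℝ) ^ (k + 1)) ^ 2 * x) ^ 2) * ((Fintype.card n : ℝ) * ∑ y ∈ periodBox (d := d) (L ^ (k + 1) * N), nhsNormSq (ζ' y)))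
        + 12 * (d : ℝ) * (48 * ((d : ℝ) * L) * ((Fintype.card n : ℝ) * ∑ y ∈ periodBox (d := d) (L ^ (k + 1) * N), ∑ κ : Fin d, nhsNormSq (η' y κ)))
        + 3 * ((d : ℝ) * (1 / ((L : ℝ) ^ (k + 1)) + 2 * (((d : ℝ) - 1) * (((L : ℝ) ^ (k + 1)) - 1) * x)) ^ 2)
          * (2 * (64 : ℝ) ^ d * ((2 : ℝ) ^ (3 * d + 2) * d * ((Fintype.card n : ℝ) * (2 * ((L : ℝ) ^ (k + 1)) ^ 2 * ∑ y ∈ periodBox (d := d) (L ^ (k + 1) * N), ∑ κ : Fin d, nhsNormSq (η' y κ) + 2 * (4 * (2 * ((4 * d + 5) / 10 * DSum d L (k + 1) x)) ^ 2 * ((L : ℝ) ^ (k + 1)) ^ 2 * ((Fintype.card n : ℝ) * ∑ y ∈ periodBox (d := d) (L ^ (k + 1) * N), ∑ κ : Fin d, nhsNormSq (η' y κ)) + 16 * S2sum d L (k + 1) x ^ 2 * ((L : ℝ) ^ d * ((L : ℝ) ^ k) ^ 2) * ((Fintype.card n : ℝ) * ∑ y ∈ periodBox (d := d) (L ^ (k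 + 1) * N), ∑ κ : Fin d, nhsNormSq (Y y κ)) + 2 * ((d : ℝ) * (20 * loopRad d L ((prop1Radius d L)^[k] x)) ^ 2) * ((Fintype.card n : ℝ) * ∑ y ∈ periodBox (d := d) (L ^ (k + 1) * N), nhsNormSq (ζ' y))))) + (2 : ℝ) ^ d * ((2 : ℝ) ^ (2 * d + 4) * (d : ℝ) ^ 2 * ((d : ℝ) - 1) ^ 2 * (radIter d L (k + 1) x) ^ 2 + 8 * (9 * (d : ℝ) ^ 2 * ((L : ℝ) ^ (k + 1)) ^ 2 * x + (d : ℝ) * (8 * loopRad d L ((prop1Radius d L)^[k] x))) ^ 2) * ((Fintype.card n : ℝ) * ∑ y ∈ periodBox (d := d) (L ^ (k + 1) * N), nhsNormSq (ζ' y)))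
            + 2 * (64 : ℝ) ^ d * (48 * ((d : ℝ) * L) * ((Fintype.card n : ℝ) * ∑ y ∈ periodBox (d := d) (L ^ (k + 1) * N), ∑ κ : Fin d, nhsNormSq (η' y κ)))))
        + 16 * (d : ℝ) * (1 / ((L : ℝ) ^ (k + 1)) + 2 * (((d : ℝ) - 1) * (((L : ℝ) ^ (k + 1)) - 1) * x)) ^ 2 * (64 : ℝ) ^ d * (4 * (d : ℝ) ^ 2 * (((L : ℝ) ^ (k + 1)) - 1) ^ 2 * x + 16 * d * loopRad d L ((prop1Radius d L)^[k] x)) ^ 2 * (Fintype.card n : ℝ)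
          * (8 * ((L : ℝ) ^ (k + 1)) ^ 2 * (3 * ((2 : ℝ) ^ (d + 1) * (((L : ℝ) ^ (k + 1)) ^ 2)⁻¹ * ((Fintype.card n : ℝ) * (2 * ((L : ℝ) ^ (k + 1)) ^ 2 * ∑ y ∈ periodBox (d := d) (L ^ (k + 1) * N), ∑ κ : Fin d, nhsNormSq (η' y κ) + 2 * (4 * (2 * ((4 * d + 5) / 10 * DSum d L (k + 1) x)) ^ 2 * ((L : ℝ) ^ (k + 1)) ^ 2 * ((Fintype.card n : ℝ) * ∑ y ∈ periodBox (d := d) (L ^ (k + 1) * N), ∑ κ : Fin d, nhsNormSq (η' y κ)) + 16 * S2sum d L (k + 1) x ^ 2 * ((L : ℝ) ^ d * ((L : ℝ) ^ k) ^ 2) * ((Fintype.card n : ℝ) * ∑ y ∈ periodBox (d := d) (L ^ (k + 1) * N), ∑ κ : Fin d, nhsNormSq (Y y κ)) + 2 * ((d : ℝ) * (20 * loopRad d L ((prop1Radius d L)^[k] x)) ^ 2) * ((Fintype.card n : ℝ) * ∑ y ∈ periodBox (d := d) (L ^ (k + 1) * N), nhsNormSq (ζ' y))))) + (d : ℝ)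 * (2 : ℝ) ^ d * (8 * ((d : ℝ) * ((L : ℝ) ^ (k + 1)) * x) ^ 2 + (16 / ((L : ℝ) ^ (k + 1)) ^ 2) * (8 * loopRad d L ((prop1Radius d L)^[k] x) + 9 * (d : ℝ) ^ 2 * ((L : ℝ) ^ (k + 1)) ^ 2 * x) ^ 2) * ((Fintype.card n : ℝ) * ∑ y ∈ periodBox (d := d) (L ^ (k + 1) * N), nhsNormSq (ζ' y)))
        + 12 * (d : ℝ) * (48 * ((d : ℝ) * L) * ((Fintype.card n : ℝ) * ∑ y ∈ periodBox (d := d) (L ^ (k + 1) * N), ∑ κ : Fin d, nhsNormSq (η' y κ)))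
        + 3 * ((d : ℝ) * (1 / ((L : ℝ) ^ (k + 1)) + 2 * (((d : ℝ) - 1) * (((L : ℝ) ^ (k + 1)) - 1) * x)) ^ 2)
          * (2 * (64 : ℝ) ^ d * ((2 : ℝ) ^ (3 * d + 2) * d * ((Fintype.card n : ℝ) * (2 * ((L : ℝ) ^ (k + 1)) ^ 2 * ∑ y ∈ periodBox (d := d) (L ^ (k + 1) * N), ∑ κ : Fin d, nhsNormSq (η' y κ) + 2 * (4 * (2 * ((4 * d + 5) / 10 * DSum d L (k + 1) x)) ^ 2 * ((L : ℝ) ^ (k + 1)) ^ 2 * ((Fintype.card n : ℝ) * ∑ y ∈ periodBox (d := d) (L ^ (k + 1) * N), ∑ κ : Fin d, nhsNormSq (η' y κ)) + 16 * S2sum d L (k + 1) x ^ 2 * ((L : ℝ) ^ d * ((L : ℝ) ^ k) ^ 2) * ((Fintype.card n : ℝ) * ∑ y ∈ periodBox (d := d) (L ^ (k + 1) * N), ∑ κ : Fin d, nhsNormSq (Y y κ)) + 2 * ((d : ℝ) * (20 * loopRad d L ((prop1Radius d L)^[k] x)) ^ 2) * ((Fintype.card n : ℝ) * ∑ y ∈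 periodBox (d := d) (L ^ (k + 1) * N), nhsNormSq (ζ' y))))) + (2 : ℝ) ^ d * ((2 : ℝ) ^ (2 * d + 4) * (d : ℝ) ^ 2 * ((d : ℝ) - 1) ^ 2 * (radIter d L (k + 1) x) ^ 2 + 8 * (9 * (d : ℝ) ^ 2 * ((L : ℝ) ^ (k + 1)) ^ 2 * x + (d : ℝ) * (8 * loopRad d L ((prop1Radius d L)^[k] x))) ^ 2) * ((Fintype.card n : ℝ) * ∑ y ∈ periodBox (d := d) (L ^ (k + 1) * N), nhsNormSq (ζ' y)))
            + 2 * (64 : ℝ) ^ d * (48 * ((d : ℝ) * L) * ((Fintype.card n : ℝ) * ∑ y ∈ periodBox (d := d) (L ^ (k + 1) * N), ∑ κ : Fin d, nhsNormSq (η' y κ)))))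
            + 8 * ((L : ℝ) ^ (k + 1)) ^ 2 * ∑ y ∈ periodBox (d := d) (L ^ (k + 1) * N), ∑ μ : Fin d, nhsNormSq (gaugeDir W ζ' y μ)
            + (4 * (Fintype.card n : ℝ) * (4 * (d : ℝ) ^ 2 * (((L : ℝ) ^ (k + 1)) - 1) ^ 2 * x + 16 * d * loopRad d L ((prop1Radius d L)^[k] x)) ^ 2 + 1) * ∑ y ∈ periodBox (d := d) (L ^ (k + 1) * N), nhsNormSq (ζ' y)) := by
  haveI : NeZero N := ⟨by omega⟩
  have hd0 : 0 < d := by omega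
  have hL1 : 1 ≤ L := le_trans (by norm_num) hL
  have hM2 : 2 ≤ L ^ (k + 1) := le_trans hL (Nat.le_self_pow (Nat.succ_ne_zero k) L)
  have hMR : (((L ^ (k + 1) : ℕ) : ℝ)) = (L : ℝ) ^ (k + 1) := by push_cast; ring
  obtain ⟨hψs, hψP⟩ := bmeanIterW_skew_periodic (M := N) hL1 k hWu hWP hx hs hWx hζ's hζ'P
  -- leaf-01-g6's competitor on the slice, BY NAME
  have hmem := nfixCompetitorW_sub_mem_cornerGaugeSpaceW hL k hWu hx hs hWx hE hd0 hWP hψs hψP hζ's hζ'P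
  obtain ⟨⟨hξP, -, hξs⟩, -⟩ :=
    (mem_cornerGaugeSpaceW_iff.1 hmem).imp_left NE3CurvedCornerGaugeSpace.mem_cornerGaugeSpace₀_iff.1
  refine ⟨nfixCompetitorW hL k hWu hx hs hWx hE (bmeanIterW L (k + 1) W ζ') ζ', hmem, ?_, ?_, ?_⟩
  · intro y τ
    have h := hξP y τ
    simp only [hζ'P y τ] at h
    exact sub_left_inj.mp h
  · intro y
    have h := (skewAdjoint (Matrix n n ℂ)).add_mem (hξs y) (hζ's y)
    simpa using h
  · -- the energy
    have hG := sum_normSq_gaugeDir_nfixCompetitorW_le hL k hWu hx hs hWx hE N hx hWx (bmeanIterW L (k + 1) W ζ') ζ'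
    rw [hMR] at hG
    have h5 := sum_normSq_gaugeDir_F0_le hd hL hN k hWu hWP hx hs hWx hS2 hY hη'P hζ'P hζ's hYeq
    have hT := pow_mul_sum_normSq_target_sub_le hL N k hWu hx hs hWx ζ'
    have hΞ := sum_nhsNormSq_F0_sub_le hL N k hWu hx hs hWx hsmall ζ'
    have hτ := two_div_tentMean_sq_le hM2 d
    have hnhs : ∑ y ∈ periodBox (d := d) (L ^ (k + 1) * N), ∑ α : Fin d,
          nhsNormSq (gaugeDir W (nfixCompetitorW hL k hWu hx hs hWx hE (bmeanIterW L (k + 1) W ζ') ζ') y α)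
        ≤ ∑ y ∈ periodBox (d := d) (L ^ (k + 1) * N), ∑ α : Fin d,
          ‖gaugeDir W (nfixCompetitorW hL k hWu hx hs hWx hE (bmeanIterW L (k + 1) W ζ') ζ') y α‖ ^ 2 :=
      sum_le_sum fun y _ => sum_le_sum fun α _ => nhsNormSq_le_opNorm_sq _
    -- signs and the scalar bookkeeping
    have hκ0 : 0 ≤ (1 / ((L : ℝ) ^ (k + 1)) + 2 * (((d : ℝ) - 1) * (((L : ℝ) ^ (k + 1)) - 1) * x)) ^ 2 := by positivity
    have hτ0 : 0 ≤ (2 / tentMean d (L ^ (k + 1))) ^ 2 := by positivity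
    have hCJ0 : 0 ≤ (4 * (d : ℝ) ^ 2 * (((L : ℝ) ^ (k + 1)) - 1) ^ 2 * x + 16 * d * loopRad d L ((prop1Radius d L)^[k] x)) ^ 2 := by positivity
    have hG00 : 0 ≤ ∑ y ∈ periodBox (d := d) (L ^ (k + 1) * N), ∑ α : Fin d, ‖gaugeDir W (competitorW (L ^ (k + 1)) W (bmeanIterW L (k + 1) W ζ') (fun z => ζ' ((((L ^ (k + 1) : ℕ) : ℤ)) • z))) y α‖ ^ 2 := sum_nonneg fun y _ => sum_nonneg fun α _ => by positivity
    have hGz0 : 0 ≤ ∑ y ∈ periodBox (d := d) (L ^ (k + 1) * N), ∑ μ : Fin d, nhsNormSq (gaugeDir W ζ' y μ) := sum_nonneg fun y _ => sum_nonneg fun μ _ => nhsNormSq_nonneg _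
    have hZ0 : 0 ≤ ∑ y ∈ periodBox (d := d) (L ^ (k + 1) * N), nhsNormSq (ζ' y) := sum_nonneg fun y _ => nhsNormSq_nonneg _
    have hcn0 : 0 ≤ (Fintype.card n : ℝ) := by positivity
    have hM20 : 0 ≤ ((L : ℝ) ^ (k + 1)) ^ 2 := by positivity
    have hdd : 0 ≤ (d : ℝ) := by positivity
    exact competitor_arith hnhs hG h5 hT hΞ hτ hκ0 hτ0 hCJ0 hG00 hGz0 hZ0 hcn0 hM20 hdd

end

end Summit.QuantumFields.BalabanUV.T4Continuum.NE3SlicePoincareCompetitorEnd
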